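import Mathlib.Analysis.SpecialFunctions.Complex.Arg
import Mathlib.Analysis.SpecialFunctions.Pow.Complex
import Summits.Schanuel.Schanuel.Theorems.ZilberEacComplexCyclicCoverRoot
import HarnessLib

/-!
# EC over double covers `xₙ² = P(x')` with one lattice value off the negative real axis

The root form of the cyclic-cover theorem (`exists_expPoint_cyclicCoverBM_avoiding_of_root`) needs
an `e`-th root `τ` of a lattice value `P_D(2πi q₀)` with `Re τ < 0`. For double covers (`e = 2`)
such a root exists exactly when `P_D(2πi q₀) ∉ (-∞, 0]`, i.e. `P_D(2πi q₀) ∈ ℂ ∖ ℝ_{≤0}`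
(`Complex.slitPlane`): take `τ = -√(P_D(2πi q₀))` (principal root, `Re √c > 0` on the slit plane;
`exists_sq_eq_of_re_neg`). This file records the resulting clean statement

* `exists_expPoint_doubleCoverBM_of_slitPlane` — **EC for `V = {xₙ² = P(x'), (x', (yⱼ - yₙFⱼ)ⱼ) ∈ W}`
  whenever `deg P ≥ 1` and `P_D(2πi q₀) ∉ ℝ_{≤0}` for ONE `q₀ ∈ ℤˢ`**, any Brownawell–Masser
  puncture fibre (the sign hypothesis `Re(ω P_D(2πiq₀)^{1/2}) < 0` of the cyclic-cover theorem is
  automatic for `ω = -1`), with EC vocabulary `doubleCoverBM_inter_expGraph_nonempty_of_slitPlane`.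

Together with `ZilberEacComplexCyclicCoverHighOrder.lean` (`e ≥ 3`: no hypothesis) this leaves, among
cyclic covers with puncture fibres glued at `yₙ → 0`, exactly the double covers whose top form takes
ONLY non-positive real values on the lattice `(2πiℤ)ˢ` — equivalently `P_D = i^{-D} R` with `R` a real
form, negative semidefinite on `ℝˢ` — e.g. the hyperboloids `xₙ² = x₁² + ⋯ + xₛ² + c`, treated (for
`deg P = 2`, graph-type fibres and `λ ≠ 0`) by `ZilberEacComplexQuadricCover.lean`.
First open rung of EAC (`dim π₁ V = n - 1`): Mantova–Masser, PLMS 129 (2024), §1 p. 5.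

HONEST FRAMING: a modest new sub-rung of Exponential-Algebraic Closedness; nothing here bears on
Schanuel's conjecture, and EAC does not imply it.
-/

noncomputable section

open Complex MvPolynomial Metric Set Filter Topology
open Literature.NumberTheory.Transcendental

set_option linter.dupNamespace false

namespace Summit.Schanuel.Schanuel.Theorems

/-- **A square root in the open left half-plane** exists for every `c` off the closed negative real
axis: `τ = -c^{1/2}` has `τ² = c` and `Re τ = -Re c^{1/2} < 0` (`|arg c| < π`). [folklore] -/
theorem exists_sq_eq_of_re_neg {c : ℂ} (hc : c ∈ slitPlane) : ∃ τ : ℂ, τ ^ 2 = c ∧ τ.re < 0 := by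
  have hc0 : c ≠ 0 := slitPlane_ne_zero hc
  refine ⟨-(c ^ ((2 : ℂ)⁻¹)), ?_, ?_⟩
  · rw [neg_sq]
    have h := Complex.cpow_nat_inv_pow c (n := 2) two_ne_zero
    simp only [Nat.cast_ofNat] at h
    exact h
  · rw [Complex.neg_re, neg_lt_zero, Complex.cpow_def_of_ne_zero hc0, Complex.exp_re]
    refine mul_pos (Real.exp_pos _) (Real.cos_pos_of_mem_Ioo ?_)
    have harg1 : Complex.arg c < Real.pi :=
      lt_of_le_of_ne (Complex.arg_le_pi c) (Complex.mem_slitPlane_iff_arg.mp hc).1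
    have harg2 : -Real.pi < Complex.arg c := Complex.neg_pi_lt_arg c
    have h2 : (2 : ℂ)⁻¹ = ((2⁻¹ : ℝ) : ℂ) := by push_cast; rfl
    have him : (Complex.log c * (2 : ℂ)⁻¹).im = Complex.arg c / 2 := by
      rw [h2, Complex.mul_im, Complex.ofReal_re, Complex.ofReal_im, mul_zero, zero_add,
        Complex.log_im]
      ring
    rw [him, Set.mem_Ioo]
    constructor <;> linarith

/-- **EC over a double cover `xₙ² = P(x')` with one lattice value off `ℝ_{≤0}`, Brownawell–Masser
puncture fibre.** Let `P ∈ ℂ[x₁..xₛ]`, `deg P ≥ 1`, and suppose `P_D(2πi q₀) ∉ (-∞,0]` for some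
`q₀ ∈ ℤˢ`. For every Brownawell–Masser variety `W ⊆ ℂˢ × ℂˢ` (irreducible, `dim W = s`, dominant
additive projection of its torus part), arbitrary `Fⱼ ∈ ℂ[u, w, x']` and `h ≠ 0` there are
`x' ∈ ℂˢ`, `xₙ ∈ ℂ` with `h(x') ≠ 0`, `xₙ² = P(x')` and `(x', (e^{xⱼ} - e^{xₙ}Fⱼ(e^{xₙ}, xₙ, x'))ⱼ) ∈ W`:
an exponential point (Zariski dense in `V` as `h` varies) of the `(s+1)`-fold
`V = {xₙ² = P(x'), (x', (yⱼ - yₙFⱼ)ⱼ) ∈ W}`, additive projection the double cover `xₙ² = P(x')`,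
`dim π₁ V = n - 1` — first open range of Exponential-Algebraic Closedness (Mantova–Masser 2024,
§1 p. 5). (The root form of the cyclic-cover theorem with `τ = -√(P_D(2πi q₀))`.) New.
[cite: MantovaMasser2023, §1 p.5 (the open case dim π(V) = 2 in ℂ³×ℂˣ³)] -/
theorem exists_expPoint_doubleCoverBM_of_slitPlane {s : ℕ} (P : MvPolynomial (Fin s) ℂ)
    (hD : 0 < P.totalDegree) (q₀ : Fin s → ℤ)
    (hslit : eval (fun j => 2 * Real.pi * I * (q₀ j : ℂ)) (homogeneousComponent P.totalDegree P) ∈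
      slitPlane)
    (W : Set (Fin s ⊕ Fin s → ℂ)) (hW : IsIrreducibleClosed ℂ W) (hdim : zariskiDim ℂ W = s)
    (hdom : HasDominantAddProjection ℂ (W ∩ torusLocus ℂ s))
    (F : Fin s → MvPolynomial (Fin (s + 2)) ℂ) (h : MvPolynomial (Fin s) ℂ) (hh : h ≠ 0) :
    ∃ x : Fin s → ℂ, ∃ xn : ℂ, eval x h ≠ 0 ∧ xn ^ 2 = eval x P ∧
      (Sum.elim x (fun j => exp (x j) - exp xn *
        eval (Fin.cons (exp xn) (Fin.cons xn x : Fin (s + 1) → ℂ)) (F j)) : Fin s ⊕ Fin s → ℂ) ∈ W := by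
  obtain ⟨τ, hτ, hre⟩ := exists_sq_eq_of_re_neg hslit
  exact exists_expPoint_cyclicCoverBM_avoiding_of_root two_pos P hD q₀ τ hτ hre W hW hdim hdom F h hh

/-- **The double-cover varieties with a lattice value off `ℝ_{≤0}` meet the graph of
exponentiation** (EC vocabulary). With `n = s + 1`, `deg P ≥ 1`, `P_D(2πi q₀) ∉ (-∞,0]` and `W`
Brownawell–Masser, `V = {xₙ² = P(x₁..xₛ), (x', (yⱼ - yₙ Fⱼ(yₙ, xₙ, x'))ⱼ) ∈ W} ⊆ ℂⁿ × ℂⁿ` contains a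
point of `Literature.NumberTheory.Transcendental.expGraph ℂ n`.
[cite: MantovaMasser2023, §1 p.5 (the open case dim π(V) = 2 in ℂ³×ℂˣ³)] -/
theorem doubleCoverBM_inter_expGraph_nonempty_of_slitPlane {s : ℕ} (P : MvPolynomial (Fin s) ℂ)
    (hD : 0 < P.totalDegree) (q₀ : Fin s → ℤ)
    (hslit : eval (fun j => 2 * Real.pi * I * (q₀ j : ℂ)) (homogeneousComponent P.totalDegree P) ∈
      slitPlane)
    (W : Set (Fin s ⊕ Fin s → ℂ)) (hW : IsIrreducibleClosed ℂ W) (hdim : zariskiDim ℂ W = s)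
    (hdom : HasDominantAddProjection ℂ (W ∩ torusLocus ℂ s))
    (F : Fin s → MvPolynomial (Fin (s + 2)) ℂ) :
    ({z : Fin (s + 1) ⊕ Fin (s + 1) → ℂ |
        z (Sum.inl (Fin.last s)) ^ 2 = eval (fun j => z (Sum.inl (Fin.castSucc j))) P ∧
        (Sum.elim (fun j => z (Sum.inl (Fin.castSucc j)))
            (fun j => z (Sum.inr (Fin.castSucc j)) - z (Sum.inr (Fin.last s)) *
              eval (Fin.cons (z (Sum.inr (Fin.last s)))
                (Fin.cons (z (Sum.inl (Fin.last s))) (fun i => z (Sum.inl (Fin.castSucc i))) :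
                  Fin (s + 1) → ℂ)) (F j)) : Fin s ⊕ Fin s → ℂ) ∈ W} ∩
      Literature.NumberTheory.Transcendental.expGraph ℂ (s + 1)).Nonempty := by
  obtain ⟨x, xn, -, hxn, hx⟩ := exists_expPoint_doubleCoverBM_of_slitPlane P hD q₀ hslit W hW hdim
    hdom F 1 one_ne_zero
  set X : Fin (s + 1) → ℂ := Fin.snoc x xn with hX
  refine ⟨Sum.elim X fun i => exp (X i), ⟨?_, ?_⟩, fun i => ?_⟩
  · simp only [Sum.elim_inl, hX, Fin.snoc_last, Fin.snoc_castSucc]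
    exact hxn
  · simp only [Sum.elim_inl, Sum.elim_inr, hX, Fin.snoc_castSucc, Fin.snoc_last]
    exact hx
  · simp [Literature.ModelTheory.ExponentialFields.ExponentialRing.complex_exp_eq]

end Summit.Schanuel.Schanuel.Theorems
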